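import Literature.NumberTheory.EllipticCurves.ShaPTorsionVanishingHigherRank
import Summits.BirchSwinnertonDyer.BirchSwinnertonDyer.Theorems.KolyvaginDepthDoorDepthTableRowsTwoSha5
import Summits.BirchSwinnertonDyer.BirchSwinnertonDyer.Theorems.KolyvaginDepthDoorDepthTableRow944e1RankDischarged
import Summits.BirchSwinnertonDyer.BirchSwinnertonDyer.Theorems.KolyvaginDepthDoorDepthTableRowsExactReading944e1
import Literature.NumberTheory.DiophantineGeometry.ConductorExponentLeEightProofs
import Literature.NumberTheory.DiophantineGeometry.TameAdditiveTypesAtTwoProofs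
import Literature.NumberTheory.EllipticCurves.SzpiroLocalDataProofs
import HarnessLib

/-!
# Route `KolyvaginDepthDoor`, crux `KolyvaginDepthSupplyKN` (stmt-BirchSwinnertonDyer-22820) —
# DEPTH TABLE v13 «ONE BIT ⟺ ONE rank-one twist» (part 11: `944e1` at `(5, −31)` — additive at `2`; conductor bound `N ∣ 2⁸·59` from `f_2 ≤ 8`; split supply)

Helper file of the lead prover of line `levelone` (kdd-p1 g17; `--supports stmt-BirchSwinnertonDyer-22820
--as helper`); it closes nothing and BSD is NOT proved by it.

Sequel of `KolyvaginDepthDoorDepthTableSteinWuthrich` (pattern at `389a1`; the named fact = Stein–Wuthrich 2013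
Thm. 1.1, `Literature.NumberTheory.EllipticCurves.SteinWuthrich2013_sha_inf_torsionBy_eq_bot_of_two_le_rank`:
`Ш(E/ℚ)[p] = 0` for every non-CM `E` of rank `≥ 2`, `N ≤ 30 000`, at every good ordinary `5 ≤ p < 1000` with
`ρ̄_{E,p}` onto). For each curve `E` below at its depth-table prime `p` and Heegner discriminant(s) `d_K`:

* `C<label>.sha_inf_torsionBy_<p>_eq_bot` — `Ш(E/ℚ)[p] = 0` BY NAME (SW Thm. 1.1 at the lineage's kernel
  certificates: non-CM, `2 ≤ rank`, `N ≤ 30000`, `p` good ordinary, `ρ̄_{E,p}` onto);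
* `C<label>.exactRow[Zhang]_<p>_neg<D>_oneTwist` — the v13 row: bit `↔` «`rank_ℤ E^{(d_K)}(ℚ) = 1` ∧
  `Ш(E^{(d_K)}/ℚ)[p] = 0`» (from the v12 «two Ш» row, the `E`-side conjunct discharged in print);
* `C<label>.exactRow[Zhang]_<p>_neg<D>_twistSelmer` — bit `↔` `#Sel_p(E^{(d_K)}/ℚ) ≤ p` (from the v11 row);
* `C<label>.cruxBody_of_twistSelmer` — the CLAUSE of the crux `KolyvaginDepthSupplyKN` at `E`, verbatim, from
  ONE `p`-Selmer bound on ONE rank-one Heegner twist (witnesses `p`, `K`, `n₁ = ℓ`, first sign `ν + 1 = 2 ≤ rank`).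

(For `944e1` the Kodaira–Néron table at `5` uses the additive-aware variant
`not_dvd_ordMinimalDiscriminant_of_intModel_table_additive` of g14 — the additive place `2` escapes via `2 ∣ c₄ = 912`.)

So at these curves the instrument's bit is exactly the `p`-part of BSD of ONE RANK-ONE curve, and the crux
instance is one rank-one datum away (not a Kolyvagin-class computation). CONDITIONAL on the rows' named print
facts ((γ) = Gross 1991 Prop. 3.7 (2) and W. Zhang 2014 Lemma 8.4 (1) / Thm. 9.1 on the ♠ rows; (γ),
Castella–Sano 2026 Thm. 3, Zanarella 2019 Prop. 2.18, Howard–Zanarella, modularity and Mazur's Manin bound on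
the split rows) and on Stein–Wuthrich 2013 Thm. 1.1, all BY NAME; per curve; nothing class-wide (the open stub
(S♭) is untouched); BSD is NOT proved by any of this.

References: [SteinWuthrich2013] Thm. 1.1 (p. 1758), §12.4; [WZhang2014] Lemma 8.4 (1), Thm. 9.1;
[CastellaSano2026] Thm. 3; [GrossLMS1991] Prop. 3.7 (2); [SilvermanAEC2009] X.4.2; [CremonaAlgorithms1997] Table 1.
-/

set_option linter.dupNamespace false

noncomputable section

open scoped Classical NumberField

namespace Summit.BirchSwinnertonDyer.BirchSwinnertonDyer.Theorems.KolyvaginDepthDoor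

open Literature.NumberTheory.EllipticCurves Literature.NumberTheory.EllipticCurves.ModularForms
  WeierstrassCurve NumberField IsDedekindDomain
open Summit.BirchSwinnertonDyer.BirchSwinnertonDyer.Theorems
open Summit.BirchSwinnertonDyer.BirchSwinnertonDyer.Rank2Observatory

/-! ## `944e1` (`N = 944`) at `p = 5` -/

namespace C944e1

/-- **`N(944e1) ∣ 2⁸·59 = 15104`** (so `N ≤ 30000`; the tree does not hold `N = 944` itself — additive at `2`):
`N = ∏ p^{f_p}` with `f_2 ≤ 8` (Brumer–Kramer / Lockhart–Rosen–Silverman, tree theorem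
`conductorExponent_le_eight_holds`) and `f_p ≤ ord_p(Δ_min)` for `p` odd (`Δ_min = −2¹⁰·59`, read off the integer model).
[cite: BrumerKramer1994, Thm 6.2] [cite: SilvermanAEC2009, VIII.8] -/
theorem conductorNorm_dvd :
    haveI := isElliptic_c944e1;
    ((⟨0, 0, 0, -19, 34⟩ : WeierstrassCurve ℤ).map (Int.castRingHom ℚ)).conductorNorm ℤ ∣ 2 ^ 8 * 59 := by
  haveI := isElliptic_c944e1
  haveI := isGloballyMinimal_c944e1
  refine conductorNorm_dvd_of_forall_conductorExponent_le _ (by norm_num) fun q => ?_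
  obtain ⟨p, hp⟩ := q
  haveI : Fact p.Prime := ⟨hp⟩
  have hgen : Rat.HeightOneSpectrum.natGenerator
      ((Rat.HeightOneSpectrum.primesEquiv (R := ℤ)).symm ⟨p, hp⟩) = p :=
    congrArg Subtype.val ((Rat.HeightOneSpectrum.primesEquiv (R := ℤ)).apply_symm_apply ⟨p, hp⟩)
  have h59 : ¬ 2 ∣ 59 := by decide
  by_cases h2 : p = 2
  · subst h2
    have h8 := conductorExponent_le_eight_holds
      ((⟨0, 0, 0, -19, 34⟩ : WeierstrassCurve ℤ).map (Int.castRingHom ℚ))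
      ((Rat.HeightOneSpectrum.primesEquiv (R := ℤ)).symm ⟨2, hp⟩)
    have hf : (2 ^ 8 * 59 : ℕ).factorization 2 = 8 := by
      rw [Nat.factorization_def _ hp, padicValNat.mul (by norm_num) (by norm_num), padicValNat.prime_pow,
        padicValNat.eq_zero_of_not_dvd h59]
    show _ ≤ (2 ^ 8 * 59 : ℕ).factorization 2
    rw [hf]
    exact h8
  · have hle := conductorExponent_le_ordMinimalDiscriminant
      ((Rat.HeightOneSpectrum.primesEquiv (R := ℤ)).symm ⟨p, hp⟩)
      ((⟨0, 0, 0, -19, 34⟩ : WeierstrassCurve ℤ).map (Int.castRingHom ℚ))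
    have hord := ordMinimalDiscriminant_eq_padicValInt_natGenerator'
      (W := (⟨0, 0, 0, -19, 34⟩ : WeierstrassCurve ℤ).map (Int.castRingHom ℚ))
      ((Rat.HeightOneSpectrum.primesEquiv (R := ℤ)).symm ⟨p, hp⟩)
    rw [hgen, Summit.BirchSwinnertonDyer.BirchSwinnertonDyer.Rank1Residual.IntModel.minimalDiscriminantInt_eq intModel]
      at hord
    have hΔ : ((⟨0, 0, 0, -19, 34⟩ : WeierstrassCurve ℤ)).Δ.natAbs = 2 ^ 2 * (2 ^ 8 * 59) := by decide +kernel
    have h4 : ¬ p ∣ 2 ^ 2 := fun h ↦ h2 ((Nat.prime_dvd_prime_iff_eq hp Nat.prime_two).mp (hp.dvd_of_dvd_pow h))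
    have hval : padicValInt p ((⟨0, 0, 0, -19, 34⟩ : WeierstrassCurve ℤ)).Δ = (2 ^ 8 * 59 : ℕ).factorization p := by
      rw [padicValInt, hΔ, padicValNat.mul (by norm_num) (by norm_num), padicValNat.eq_zero_of_not_dvd h4,
        zero_add, Nat.factorization_def _ hp]
    show _ ≤ (2 ^ 8 * 59 : ℕ).factorization p
    rw [← hval, ← hord]
    exact hle

/-- **`Ш(944e1/ℚ)[5] = 0` BY NAME** (Stein–Wuthrich 2013 Thm. 1.1 at the kernel-certified hypotheses of the
lineage: non-CM `not_hasCM`, `2 ≤ rank` `KernelCerts002.C944e1.two_le_rank`, `N ≤ `N ∣ 2⁸·59 = 15104 ≤ 30000` (`conductorNorm_dvd`: `f_2 ≤ 8` + `f_p ≤ ord_p Δ_min`; `N = 944` itself is not in the tree — additive at `2`)` , `5` good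
ordinary `goodOrdinary_5`, `ρ̄_{E,5}` onto `hasSurjectiveModNGaloisRep_pow_5 1`). CONDITIONAL on that named fact; per curve;
BSD is not proved by it. [cite: SteinWuthrich2013, Thm. 1.1 (p. 1758)] [cite: CremonaAlgorithms1997, Table 1 (944e1)] -/
theorem sha_inf_torsionBy_five_eq_bot (hSW : SteinWuthrich2013_sha_inf_torsionBy_eq_bot_of_two_le_rank) :
    haveI := isElliptic_c944e1;
    haveI := isGloballyMinimal_c944e1;
    haveI := Fact.mk (by norm_num : Nat.Prime 5);
    (((⟨0, 0, 0, -19, 34⟩ : WeierstrassCurve ℤ).map (Int.castRingHom ℚ)).sha ⊓ AddSubgroup.torsionBy ((⟨0, 0, 0, -19, 34⟩ : WeierstrassCurve ℤ).map (Int.castRingHom ℚ)).galH1 ((5 : ℕ) : ℤ) : AddSubgroup _) = ⊥ := by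
  haveI := isElliptic_c944e1
  haveI := isGloballyMinimal_c944e1
  haveI := Fact.mk (by norm_num : Nat.Prime 5)
  have hsur : ((⟨0, 0, 0, -19, 34⟩ : WeierstrassCurve ℤ).map (Int.castRingHom ℚ)).HasSurjectiveModNGaloisRep (5 ^ 1 : ℕ) := hasSurjectiveModNGaloisRep_pow_5 1
  rw [pow_one] at hsur
  exact hSW _ not_hasCM KernelCerts002.C944e1.two_le_rank ((Nat.le_of_dvd (by norm_num) conductorNorm_dvd).trans (by norm_num)) 5 (by norm_num) (by norm_num)
    goodOrdinary_5.1 goodOrdinary_5.2 hsur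

/-- **DEPTH-TABLE ROW `944e1`, `(p, d_K) = (5, -31)`, v13 — «ONE BIT ⟺ ONE TWIST».** For `E = 944e1` and ANY
imaginary quadratic `K` with `d_K = -31`: «some frame, some Kolyvagin prime `ℓ`, some datum of conductor `ℓ` with
`c_1(ℓ) ≠ 0`» `↔` «`rank_ℤ E^{(-31)}(ℚ) = 1` ∧ `Ш(E^{(-31)}/ℚ)[5] = 0`» — the `5`-part of BSD for the rank-one
Heegner twist ALONE. From the v12 row `exactRow_5_neg31_twoSha` with its conjunct `Ш(E)[5] = 0` discharged by
Stein–Wuthrich Thm. 1.1 (`sha_inf_torsionBy_five_eq_bot`). CONDITIONAL on (γ), Castella–Sano Thm. 3, Zanarella Prop. 2.18, Howard–Zanarella, modularity, Mazur's Manin bound and SW Thm. 1.1 by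
name; per curve; BSD is not proved by it. [cite: SteinWuthrich2013, Thm. 1.1 (p. 1758)] [cite: CastellaSano2026, Thm. 3] [cite: GrossLMS1991, Prop. 3.7 (2)]
[cite: SilvermanAEC2009, Thm. X.4.2] -/
theorem exactRow_5_neg31_oneTwist
    (hSW : SteinWuthrich2013_sha_inf_torsionBy_eq_bot_of_two_le_rank)
    (h372 : GrossLMS1991.prop37_2_frobeniusCongruence)
    (h3 : Literature.NumberTheory.EllipticCurves.CastellaSano2026_kolyvaginClass_selmerDivisibility_eq_padicValNat_tamagawaProduct)
    (hZ : Literature.NumberTheory.EllipticCurves.Zanarella2019_kolyvaginClass_one_ne_zero_of_not_selmerDivisible)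
    (hHZ : Literature.NumberTheory.EllipticCurves.HowardZanarella_exists_minimal_kolyvaginClass_one_selmerCard_of_ne_zero)
    (hnf : exists_isNewformOf) (hMaz : mazur_not_dvd_maninConstant_of_odd)
    (K : Type) [Field K] [NumberField K] (hK : IsImaginaryQuadratic K)
    (hD : NumberField.discr K = -31) :
    haveI := isElliptic_c944e1;
    haveI := isGloballyMinimal_c944e1;
    haveI : NeZero (((⟨0, 0, 0, -19, 34⟩ : WeierstrassCurve ℤ).map (Int.castRingHom ℚ)).conductorNorm ℤ) := neZero_conductorNorm_of_isElliptic _;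
    haveI := Fact.mk (by norm_num : Nat.Prime 5);
    (∃ (Dt : ModularParametrizationData ((⟨0, 0, 0, -19, 34⟩ : WeierstrassCurve ℤ).map (Int.castRingHom ℚ)) (((⟨0, 0, 0, -19, 34⟩ : WeierstrassCurve ℤ).map (Int.castRingHom ℚ)).conductorNorm ℤ)) (β : ℤ)
      (ι : K →+* ℂ) (ℓ : ℕ) (d : KolyvaginHeegnerData Dt β ι ℓ),
      ℓ.Prime ∧ Zhang2014.IsKolyvaginPrime (((⟨0, 0, 0, -19, 34⟩ : WeierstrassCurve ℤ).map (Int.castRingHom ℚ)).conductorNorm ℤ) ((⟨0, 0, 0, -19, 34⟩ : WeierstrassCurve ℤ).map (Int.castRingHom ℚ)) K 5 ℓ ∧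
        d.kolyvaginClass (p := 5) (by norm_num) 1 ≠ 0) ↔
    ((((⟨0, 0, 0, -19, 34⟩ : WeierstrassCurve ℤ).map (Int.castRingHom ℚ)).quadraticTwist (NumberField.discr K : ℚ)).mordellWeilRank = 1 ∧
      ((((⟨0, 0, 0, -19, 34⟩ : WeierstrassCurve ℤ).map (Int.castRingHom ℚ)).quadraticTwist (NumberField.discr K : ℚ)).sha ⊓
          AddSubgroup.torsionBy (((⟨0, 0, 0, -19, 34⟩ : WeierstrassCurve ℤ).map (Int.castRingHom ℚ)).quadraticTwist (NumberField.discr K : ℚ)).galH1 ((5 : ℕ) : ℤ) :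
          AddSubgroup (((⟨0, 0, 0, -19, 34⟩ : WeierstrassCurve ℤ).map (Int.castRingHom ℚ)).quadraticTwist (NumberField.discr K : ℚ)).galH1) = ⊥) := by
  haveI := isElliptic_c944e1
  haveI := isGloballyMinimal_c944e1
  haveI : NeZero (((⟨0, 0, 0, -19, 34⟩ : WeierstrassCurve ℤ).map (Int.castRingHom ℚ)).conductorNorm ℤ) := neZero_conductorNorm_of_isElliptic _
  haveI := Fact.mk (by norm_num : Nat.Prime 5)
  exact (exactRow_5_neg31_twoSha h372 h3 hZ hHZ hnf hMaz K hK hD).trans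
    (and_iff_right (sha_inf_torsionBy_five_eq_bot hSW))

/-- **DEPTH-TABLE ROW `944e1`, `(p, d_K) = (5, -31)`, v13 in Selmer currency — «ONE BIT ⟺ ONE TWIST-SELMER
BOUND».** For `E = 944e1` and ANY imaginary quadratic `K` with `d_K = -31`: bit `↔` `#Sel_5(E^{(-31)}/ℚ) ≤ 5`
(`dim Sel_5(E^{(-31)}) ≤ 1` over `𝔽_5`). From the v11 row `exactRow_5_neg31_rankFree` with `Ш(E)[5] = 0` discharged by
SW Thm. 1.1. CONDITIONAL on (γ), Castella–Sano Thm. 3, Zanarella Prop. 2.18, Howard–Zanarella, modularity, Mazur's Manin bound and SW Thm. 1.1 by name; per curve; BSD is not proved by it.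
[cite: SteinWuthrich2013, Thm. 1.1 (p. 1758)] [cite: CastellaSano2026, Thm. 3] [cite: GrossLMS1991, Prop. 3.7 (2)] -/
theorem exactRow_5_neg31_twistSelmer
    (hSW : SteinWuthrich2013_sha_inf_torsionBy_eq_bot_of_two_le_rank)
    (h372 : GrossLMS1991.prop37_2_frobeniusCongruence)
    (h3 : Literature.NumberTheory.EllipticCurves.CastellaSano2026_kolyvaginClass_selmerDivisibility_eq_padicValNat_tamagawaProduct)
    (hZ : Literature.NumberTheory.EllipticCurves.Zanarella2019_kolyvaginClass_one_ne_zero_of_not_selmerDivisible)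
    (hHZ : Literature.NumberTheory.EllipticCurves.HowardZanarella_exists_minimal_kolyvaginClass_one_selmerCard_of_ne_zero)
    (hnf : exists_isNewformOf) (hMaz : mazur_not_dvd_maninConstant_of_odd)
    (K : Type) [Field K] [NumberField K] (hK : IsImaginaryQuadratic K)
    (hD : NumberField.discr K = -31) :
    haveI := isElliptic_c944e1;
    haveI := isGloballyMinimal_c944e1;
    haveI : NeZero (((⟨0, 0, 0, -19, 34⟩ : WeierstrassCurve ℤ).map (Int.castRingHom ℚ)).conductorNorm ℤ) := neZero_conductorNorm_of_isElliptic _;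
    haveI := Fact.mk (by norm_num : Nat.Prime 5);
    (∃ (Dt : ModularParametrizationData ((⟨0, 0, 0, -19, 34⟩ : WeierstrassCurve ℤ).map (Int.castRingHom ℚ)) (((⟨0, 0, 0, -19, 34⟩ : WeierstrassCurve ℤ).map (Int.castRingHom ℚ)).conductorNorm ℤ)) (β : ℤ)
      (ι : K →+* ℂ) (ℓ : ℕ) (d : KolyvaginHeegnerData Dt β ι ℓ),
      ℓ.Prime ∧ Zhang2014.IsKolyvaginPrime (((⟨0, 0, 0, -19, 34⟩ : WeierstrassCurve ℤ).map (Int.castRingHom ℚ)).conductorNorm ℤ) ((⟨0, 0, 0, -19, 34⟩ : WeierstrassCurve ℤ).map (Int.castRingHom ℚ)) K 5 ℓ ∧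
        d.kolyvaginClass (p := 5) (by norm_num) 1 ≠ 0) ↔
    Nat.card ((((⟨0, 0, 0, -19, 34⟩ : WeierstrassCurve ℤ).map (Int.castRingHom ℚ)).quadraticTwist (NumberField.discr K : ℚ)).selmerGroup (5 : ℕ)) ≤ 5 := by
  haveI := isElliptic_c944e1
  haveI := isGloballyMinimal_c944e1
  haveI : NeZero (((⟨0, 0, 0, -19, 34⟩ : WeierstrassCurve ℤ).map (Int.castRingHom ℚ)).conductorNorm ℤ) := neZero_conductorNorm_of_isElliptic _
  haveI := Fact.mk (by norm_num : Nat.Prime 5)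
  exact (exactRow_5_neg31_rankFree h372 h3 hZ hHZ hnf hMaz K hK hD).trans
    (and_iff_right (sha_inf_torsionBy_five_eq_bot hSW))

/-- **THE CRUX `KolyvaginDepthSupplyKN` AT `944e1`, MODULO ONE RANK-ONE DATUM.** Granted the named print facts
(SW Thm. 1.1, (γ), Castella–Sano Thm. 3, Zanarella Prop. 2.18, Howard–Zanarella, modularity, Mazur's Manin bound) and, for ONE imaginary quadratic `K` with `d_K = -31`, the `5`-Selmer bound
`#Sel_5(E^{(d_K)}/ℚ) ≤ 5` of the rank-one Heegner twist (one `5`-descent-free rank-one datum), the CLAUSE of the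
crux holds at `W = 944e1` VERBATIM: witnesses `p = 5` (good ordinary, `ρ_{E,5^∞}` onto `hasSurjectiveModNGaloisRep_pow_5`,
Kodaira–Néron from `Δ(E₀) = -60416`), that `K` (Heegner, `heegner_neg31`), `n₁ = ℓ` the Kolyvagin prime of the row's
non-zero class (`exactRow_5_neg31_twistSelmer`, ←), first sign `ν(ℓ) + 1 = 2 ≤ rank_ℤ E(ℚ)` (`KernelCerts002.C944e1.two_le_rank`).
CONDITIONAL on the named facts and the one twist datum; per curve (the open stub (S♭) is untouched); BSD is not proved
by it. [cite: SteinWuthrich2013, Thm. 1.1 (p. 1758)] [cite: CastellaSano2026, Thm. 3] [cite: GrossLMS1991, Prop. 3.7 (2)] [cite: CremonaAlgorithms1997, Table 1 (944e1)] -/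
theorem cruxBody_of_twistSelmer
    (hSW : SteinWuthrich2013_sha_inf_torsionBy_eq_bot_of_two_le_rank)
    (h372 : GrossLMS1991.prop37_2_frobeniusCongruence)
    (h3 : Literature.NumberTheory.EllipticCurves.CastellaSano2026_kolyvaginClass_selmerDivisibility_eq_padicValNat_tamagawaProduct)
    (hZ : Literature.NumberTheory.EllipticCurves.Zanarella2019_kolyvaginClass_one_ne_zero_of_not_selmerDivisible)
    (hHZ : Literature.NumberTheory.EllipticCurves.HowardZanarella_exists_minimal_kolyvaginClass_one_selmerCard_of_ne_zero)
    (hnf : exists_isNewformOf) (hMaz : mazur_not_dvd_maninConstant_of_odd)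
    (K : Type) [Field K] [NumberField K] (hK : IsImaginaryQuadratic K)
    (hD : NumberField.discr K = -31)
    (hT : haveI := isElliptic_c944e1; haveI := isGloballyMinimal_c944e1; 
      Nat.card ((((⟨0, 0, 0, -19, 34⟩ : WeierstrassCurve ℤ).map (Int.castRingHom ℚ)).quadraticTwist (NumberField.discr K : ℚ)).selmerGroup (5 : ℕ)) ≤ 5) :
    haveI := isElliptic_c944e1;
    haveI := isGloballyMinimal_c944e1;
    ∃ (p : ℕ) (hp : Fact p.Prime), 5 ≤ p ∧ ((⟨0, 0, 0, -19, 34⟩ : WeierstrassCurve ℤ).map (Int.castRingHom ℚ)).HasGoodReductionAtPrime p ∧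
      ¬ (p : ℤ) ∣ ((⟨0, 0, 0, -19, 34⟩ : WeierstrassCurve ℤ).map (Int.castRingHom ℚ)).frobeniusTrace p ∧ (∀ n : ℕ, ((⟨0, 0, 0, -19, 34⟩ : WeierstrassCurve ℤ).map (Int.castRingHom ℚ)).HasSurjectiveModNGaloisRep (p ^ n : ℕ)) ∧
      (∀ v : HeightOneSpectrum (𝓞 ℚ), ((⟨0, 0, 0, -19, 34⟩ : WeierstrassCurve ℤ).map (Int.castRingHom ℚ)).HasMultiplicativeReductionAt v →
        ¬ p ∣ ((⟨0, 0, 0, -19, 34⟩ : WeierstrassCurve ℤ).map (Int.castRingHom ℚ)).ordMinimalDiscriminant v) ∧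
      ∃ (K : Type) (_ : Field K) (_ : NumberField K), IsImaginaryQuadratic K ∧
        NumberField.discr K ≠ -3 ∧ NumberField.discr K ≠ -4 ∧
        ∃ (_ : NeZero (((⟨0, 0, 0, -19, 34⟩ : WeierstrassCurve ℤ).map (Int.castRingHom ℚ)).conductorNorm ℤ)), SatisfiesHeegnerHypothesis (((⟨0, 0, 0, -19, 34⟩ : WeierstrassCurve ℤ).map (Int.castRingHom ℚ)).conductorNorm ℤ) K ∧
        ∃ (Dt : ModularParametrizationData ((⟨0, 0, 0, -19, 34⟩ : WeierstrassCurve ℤ).map (Int.castRingHom ℚ)) (((⟨0, 0, 0, -19, 34⟩ : WeierstrassCurve ℤ).map (Int.castRingHom ℚ)).conductorNorm ℤ)) (β : ℤ) (ι : K →+* ℂ) (n₁ : ℕ)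
          (d : KolyvaginHeegnerData Dt β ι n₁), Squarefree n₁ ∧
          (∀ q ∈ n₁.primeFactors, Zhang2014.IsKolyvaginPrime (((⟨0, 0, 0, -19, 34⟩ : WeierstrassCurve ℤ).map (Int.castRingHom ℚ)).conductorNorm ℤ) ((⟨0, 0, 0, -19, 34⟩ : WeierstrassCurve ℤ).map (Int.castRingHom ℚ)) K p q) ∧
          d.kolyvaginClass hp.out 1 ≠ 0 ∧
          (n₁.primeFactors.card + 1 ≤ ((⟨0, 0, 0, -19, 34⟩ : WeierstrassCurve ℤ).map (Int.castRingHom ℚ)).mordellWeilRank ∨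
            (n₁.primeFactors.card ≤ ((⟨0, 0, 0, -19, 34⟩ : WeierstrassCurve ℤ).map (Int.castRingHom ℚ)).mordellWeilRank ∧
              n₁.primeFactors.card + 1 ≤ (((⟨0, 0, 0, -19, 34⟩ : WeierstrassCurve ℤ).map (Int.castRingHom ℚ)).quadraticTwist (NumberField.discr K : ℚ)).mordellWeilRank)) := by
  haveI := isElliptic_c944e1
  haveI := isGloballyMinimal_c944e1
  haveI iNZ : NeZero (((⟨0, 0, 0, -19, 34⟩ : WeierstrassCurve ℤ).map (Int.castRingHom ℚ)).conductorNorm ℤ) := neZero_conductorNorm_of_isElliptic _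
  haveI iP := Fact.mk (by norm_num : Nat.Prime 5)
  -- the non-zero class at a Kolyvagin PRIME, from the v13 row (←) and the twist datum
  obtain ⟨Dt, β, ι, ℓ, d, hℓ, hkol, hne⟩ := (exactRow_5_neg31_twistSelmer hSW h372 h3 hZ hHZ hnf hMaz K hK hD).mpr hT
  -- Kodaira–Néron at `5` from `Δ(E₀) = -60416`
  have hKN : ∀ v : HeightOneSpectrum (𝓞 ℚ), ((⟨0, 0, 0, -19, 34⟩ : WeierstrassCurve ℤ).map (Int.castRingHom ℚ)).HasMultiplicativeReductionAt v →
      ¬ 5 ∣ ((⟨0, 0, 0, -19, 34⟩ : WeierstrassCurve ℤ).map (Int.castRingHom ℚ)).ordMinimalDiscriminant v :=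
    not_dvd_ordMinimalDiscriminant_of_intModel_table_additive intModel (p := 5) (Δ₀ := -60416) (c₀ := 912)
      (by decide +kernel) (by decide +kernel) (B := 10) (by decide +kernel) (by decide +kernel)
  have hH := satisfiesHeegnerHypothesis_conductorNorm_of_intModel intModel K hK.1 hD heegner_neg31
  have hD3 : NumberField.discr K ≠ -3 := by rw [hD]; norm_num
  have hD4 : NumberField.discr K ≠ -4 := by rw [hD]; norm_num
  have hsq : Squarefree ℓ := hℓ.squarefree
  have h5 : (5 : ℕ) ≤ 5 := by norm_num
  have hgood : ((⟨0, 0, 0, -19, 34⟩ : WeierstrassCurve ℤ).map (Int.castRingHom ℚ)).HasGoodReductionAtPrime 5 := goodOrdinary_5.1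
  have hord : ¬ ((5 : ℕ) : ℤ) ∣ ((⟨0, 0, 0, -19, 34⟩ : WeierstrassCurve ℤ).map (Int.castRingHom ℚ)).frobeniusTrace 5 := goodOrdinary_5.2
  have htower : ∀ n : ℕ, ((⟨0, 0, 0, -19, 34⟩ : WeierstrassCurve ℤ).map (Int.castRingHom ℚ)).HasSurjectiveModNGaloisRep (5 ^ n : ℕ) := hasSurjectiveModNGaloisRep_pow_5
  have hkol' : ∀ q ∈ ℓ.primeFactors, Zhang2014.IsKolyvaginPrime (((⟨0, 0, 0, -19, 34⟩ : WeierstrassCurve ℤ).map (Int.castRingHom ℚ)).conductorNorm ℤ) ((⟨0, 0, 0, -19, 34⟩ : WeierstrassCurve ℤ).map (Int.castRingHom ℚ)) K 5 q := by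
    intro q hq
    rw [hℓ.primeFactors, Finset.mem_singleton] at hq
    exact hq ▸ hkol
  have hrank : ℓ.primeFactors.card + 1 ≤ ((⟨0, 0, 0, -19, 34⟩ : WeierstrassCurve ℤ).map (Int.castRingHom ℚ)).mordellWeilRank := by
    rw [hℓ.primeFactors, Finset.card_singleton]
    exact KernelCerts002.C944e1.two_le_rank
  have hne' : d.kolyvaginClass iP.out 1 ≠ 0 := hne
  -- assembled one binder at a time (a single anonymous constructor here times out at `whnf`)
  refine ⟨5, iP, h5, hgood, hord, htower, hKN, ?_⟩
  refine ⟨K, ‹Field K›, ‹NumberField K›, ?_⟩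
  refine ⟨hK, ?_⟩
  refine ⟨hD3, ?_⟩
  refine ⟨hD4, ?_⟩
  refine ⟨iNZ, ?_⟩
  refine ⟨hH, ?_⟩
  refine ⟨Dt, β, ι, ℓ, d, ?_⟩
  refine ⟨hsq, ?_⟩
  refine ⟨hkol', ?_⟩
  refine ⟨hne', ?_⟩
  exact Or.inl hrank

end C944e1

end Summit.BirchSwinnertonDyer.BirchSwinnertonDyer.Theorems.KolyvaginDepthDoor

end
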